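import Literature.AlgebraicGeometry.Frobenioids.BirationalizationProp44iiiCounterexample
import Literature.AlgebraicGeometry.Frobenioids.BirationalizationProp44UnitsProofs
import Literature.AlgebraicGeometry.Frobenioids.BiratPathsDiv
import Literature.AlgebraicGeometry.Frobenioids.FrTrFrobenioid
import Literature.AlgebraicGeometry.Frobenioids.ModelFrobenioidIsFrobenioid
import Literature.AlgebraicGeometry.Frobenioids.ModelFrobenioidRationalFunctionsProofs
import Literature.AlgebraicGeometry.Frobenioids.TwoLevelFrobenioidClauses
import HarnessLib

/-!
# Frobenioids I, Proposition 4.4 (iii): the clause «`C^birat → F_{Φ^gp}` factors through `F_{Φ^birat}`»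
# is incompatible with the surjections `O^×(A^birat) ↠ Φ^birat(A^birat)` — a model Frobenioid witness

Mochizuki, *The geometry of Frobenioids I: the general theory*, Kyushu J. Math. **62** (2008)
293–400, §4, Proposition 4.4 (iii), kurims text p. 83 l. 25–32 [cite: MochizukiFrdI2008, Prop. 4.4 (iii) p.83]:
"There exists a unique subfunctor of groups `Φ^birat ⊆ Φ^gp` such that the functor `C^birat → F_{Φ^gp}`
of (i) FACTORS THROUGH THE SUBCATEGORY `F_{Φ^birat} ⊆ F_{Φ^gp}` determined by `Φ^birat`, and, moreover,
the resulting functor `C^birat → F_{Φ^birat}` induces, for each `A^birat ∈ Ob(C^birat)`, a surjection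
`O^×(A^birat) ↠ Φ^birat(A^birat)` …"; Theorem 5.2 (ii) p. 100–101: for the model Frobenioid of
`(Φ, B, Div_B)`, "the group-like monoid determined by the image of `Div_B`" is `Φ^birat`, and `B` is its
rational function monoid [cite: MochizukiFrdI2008, Thm. 5.2 (ii) p.101].

OURS (abc-iut cell, seat abc-iut-w4-d020; finding F-w4d020-2, companion of F-w4d020-1 / erratum E-15):
the two printed requirements on `Φ^birat` cannot hold together once some divisor is not "principal".
WITNESS: the MODEL Frobenioid `C := ModelFrobenioid Φ 0_D 0` (Thm. 5.2, abc-iut-found's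
`ModelFrobenioid.isFrobenioid`; ISOTROPIC and MODEL type) over `D = B(ℤ/2)` with `Φ ≡ ℤ_{≥0}` (the divisor
monoid of the cell's two-level Frobenioid) and TRIVIAL rational function monoid `B = 0_D`, `Div_B = 0`:
* the arrow `(∗, 0) → (∗, 1)` of `C` (degree `1`, base `id`, zero divisor `1 ∈ ℤ_{≥0}`, unit `1`) maps in
  `C^birat → F_{Φ^gp}` to an arrow with `Φ^gp`-divisor `1 ∈ ℤ` (`gpDiv_step`), so ANY `Φ^birat(∗)` through
  which the functor factors contains `1`;
* every unit of `(∗, 0)^birat` has `Φ^gp`-divisor `Div_B`(its unit part) `= 0` (`biratDivHom_eq_one`,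
  abc-iut-L6-t8's `ModelFrobenioid.div_eq_divB_ratUnit`), so `1` is not in the image of
  `O^×((∗,0)^birat)`.
Hence `not_exists_factorization_and_surjection`: there is NO family of subgroups `P(X) ⊆ Φ^gp(X)`
(a fortiori no subfunctor) with both (a) all `Φ^gp`-divisors of arrows of `C^birat` in `P` and (b)
`O^×(A^birat) ↠ P(Base A)` for all `A`. The tree's typed `PreFrobenioidData.Prop44iii` (abc-iut-L1-t3)
encodes only the surjection/kernel clauses and `divBirat_mem` for UNITS — the evidently intended reading
(Thm. 5.1's `Pic_Φ(A) := Φ^gp(A)/Φ^birat(A)` presupposes `Φ^birat ≠ Φ^gp`); this file records that the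
additional printed factorization clause is false as printed (for every Frobenioid with a non-principal
divisor; here kernel-checked on one). PROOF-ONLY file. Nothing here bears on the disputed parts of
[IUTchIII].
-/

namespace Literature.AlgebraicGeometry.Frobenioids

open CategoryTheory Opposite

namespace TwoLevel

open PreFrobenioid

/-! ### The witness: the model Frobenioid of `(B(ℤ/2), ℤ_{≥0}, 0_D, 0)` -/

variable (DivB : zeroMonoid.{0} D ⟶ monoidGp Φ)

/-- `0_D` on `B(ℤ/2)` is objectwise group-like. [cite: MochizukiFrdI2008, Thm. 5.2 p.100] -/
theorem isGroupLike_zeroMonoid : Objectwise (fun M _ => IsGroupLike M) (zeroMonoid.{0} D) := fun A =>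
  { isPreDivisorial := (isDivisorial_zeroMonoid (D := D) A).isPreDivisorial
    subsingleton_associates := ⟨fun a b => by
      obtain ⟨a, rfl⟩ := Associates.mk_surjective a
      obtain ⟨b, rfl⟩ := Associates.mk_surjective b
      rw [Subsingleton.elim a b]⟩ }

/-- Any `Div_B : 0_D → Φ^gp` is trivial. [cite: MochizukiFrdI2008, Thm. 5.2 p.100] -/
theorem divB_eq_one (A : Dᵒᵖ) (u : (zeroMonoid.{0} D).obj A) : divB Φ (zeroMonoid.{0} D) DivB A u = 1 := by
  rw [Subsingleton.elim u 1, map_one]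

/-- `Div_B = 0 : 0_D → Φ^gp` exists (the refutation below is about an actual Frobenioid).
[cite: MochizukiFrdI2008, Thm. 5.2 p.100] -/
theorem nonempty_divB : Nonempty (zeroMonoid.{0} D ⟶ monoidGp Φ) :=
  ⟨{ app := fun A => CommMonCat.ofHom (1 : (zeroMonoid.{0} D).obj A →* _)
     naturality := fun A A' f => by
       ext u
       change (1 : Algebra.GrothendieckGroup (Φ.obj A')) = (CommMonCat.Hom.hom ((monoidGp Φ).map f)) 1
       rw [map_one]
       rfl }⟩

/-- The model Frobenioid `C` of `(Φ ≡ ℤ_{≥0}, B = 0_D, Div_B)` over `B(ℤ/2)` is a Frobenioid — of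
isotropic and model type (Thm. 5.2 (ii); abc-iut-found's `ModelFrobenioid.isFrobenioid`).
[cite: MochizukiFrdI2008, Thm. 5.2 (ii) p.101] -/
theorem model_isFrobenioid : IsFrobenioid (ModelFrobenioid.toElem Φ (zeroMonoid.{0} D) DivB) :=
  ModelFrobenioid.isFrobenioid isMonoidOn_Φ isDivisorial_Φ isMonoidOn_zeroMonoid isGroupLike_zeroMonoid
    isGraphConnected_D isTotallyEpimorphic_D

/-- Every unit of `A^birat`, `A` an object of the model Frobenioid with `B = 0_D`, has TRIVIAL
`Φ^gp`-divisor: it is `Div_B` of the unit part of the fraction (abc-iut-L6-t8's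
`ModelFrobenioid.div_eq_divB_ratUnit`). [cite: MochizukiFrdI2008, Thm. 5.2 (ii) p.101] -/
theorem biratDivHom_eq_one (hsq : HasBiratSquares (ModelFrobenioid.toElem Φ (zeroMonoid.{0} D) DivB))
    (A : ModelFrobenioid Φ (zeroMonoid.{0} D) DivB)
    (u : (biratOps (model_isFrobenioid DivB) hsq).unitsSubgroup
      ((toBirat (ModelFrobenioid.toElem Φ (zeroMonoid.{0} D) DivB) (model_isFrobenioid DivB) hsq).obj A)) :
    biratDivHom (model_isFrobenioid DivB) hsq A u = 1 := by
  obtain ⟨x, rfl⟩ := toAut_surjective_unitsSubgroup (hsq := hsq) u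
  rw [biratDivHom_toAut]
  obtain ⟨p, rfl⟩ := BiratUnits.mk_surjective x
  rw [BiratUnits.divHom_mk, ModelFrobenioid.div_eq_divB_ratUnit isGroupLike_zeroMonoid p, divB_eq_one]
  rfl

/-- The arrow `(∗, 0) → (∗, 1)` of the model Frobenioid (degree `1`, base `id`, zero divisor `1`,
unit `1`) maps under `C → C^birat → F_{Φ^gp}` to an arrow of `Φ^gp`-divisor `1 ∈ ℤ = Φ^gp(∗)` — a value
NOT attained by the units of `(∗, 0)^birat`. [cite: MochizukiFrdI2008, Prop. 4.4 (iii) p.83] -/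
theorem exists_gpDiv_eq_of_one (hsq : HasBiratSquares (ModelFrobenioid.toElem Φ (zeroMonoid.{0} D) DivB)) :
    ∃ (A A' : ModelFrobenioid Φ (zeroMonoid.{0} D) DivB)
      (f : (toBirat (ModelFrobenioid.toElem Φ (zeroMonoid.{0} D) DivB) (model_isFrobenioid DivB) hsq).obj A ⟶
        (toBirat (ModelFrobenioid.toElem Φ (zeroMonoid.{0} D) DivB) (model_isFrobenioid DivB) hsq).obj A'),
      Birat.gpDiv f = Algebra.GrothendieckGroup.of
        (M := Φ.obj (op (baseObj (ModelFrobenioid.toElem Φ (zeroMonoid.{0} D) DivB) A)))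
        (Multiplicative.ofAdd (1 : ℕ)) := by
  let A₀ : ModelFrobenioid Φ (zeroMonoid.{0} D) DivB := ⟨SingleObj.star X, 1⟩
  let A₁ : ModelFrobenioid Φ (zeroMonoid.{0} D) DivB :=
    ⟨SingleObj.star X, Algebra.GrothendieckGroup.of (M := Φ.obj (op (SingleObj.star X)))
      (Multiplicative.ofAdd (1 : ℕ))⟩
  let φ : A₀ ⟶ A₁ :=
    ⟨1, 𝟙 _, Multiplicative.ofAdd (1 : ℕ), 1, by
      change (1 : Algebra.GrothendieckGroup (Φ.obj (op (SingleObj.star X)))) ^ ((1 : ℕ+) : ℕ) *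
          Algebra.GrothendieckGroup.of (M := Φ.obj (op (SingleObj.star X))) (Multiplicative.ofAdd (1 : ℕ)) =
        pullGp Φ (𝟙 (SingleObj.star X))
          (Algebra.GrothendieckGroup.of (M := Φ.obj (op (SingleObj.star X))) (Multiplicative.ofAdd (1 : ℕ))) *
        divB Φ (zeroMonoid.{0} D) DivB (op (SingleObj.star X)) 1
      rw [pullGp_id, divB_eq_one, one_pow, one_mul, mul_one]⟩
  refine ⟨A₀, A₁, (toBirat _ (model_isFrobenioid DivB) hsq).map φ, ?_⟩
  rw [Birat.gpDiv_map]
  rfl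

/-! ### The refutation -/

/-- **[FrdI] Prop. 4.4 (iii): the factorization clause and the surjectivity clause are INCOMPATIBLE for
the model Frobenioid of `(B(ℤ/2), ℤ_{≥0}, 0_D, 0)`** (a Frobenioid of isotropic and model type): there is
NO family of subgroups `P(Y) ⊆ Φ^gp(Y)`, `Y ∈ Ob(D)` — in particular no subfunctor `Φ^birat ⊆ Φ^gp` —
such that (a) every arrow of `C^birat` has its `Φ^gp`-divisor in `P` («`C^birat → F_{Φ^gp}` factors through
`F_{Φ^birat}`») and (b) `O^×(A^birat) ↠ P(Base A)` for every `A`. The intended reading (Thm. 5.1, Thm. 5.2: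
`Φ^birat(A)` = image of the units; the cell's typed `Prop44iii`) drops (a).
[cite: MochizukiFrdI2008, Prop. 4.4 (iii) p.83] -/
theorem not_exists_factorization_and_surjection
    (hsq : HasBiratSquares (ModelFrobenioid.toElem Φ (zeroMonoid.{0} D) DivB)) :
    ¬ ∃ P : ∀ Y : D, Subgroup (Algebra.GrothendieckGroup (Φ.obj (op Y))),
      (∀ (A A' : ModelFrobenioid Φ (zeroMonoid.{0} D) DivB)
          (f : (toBirat (ModelFrobenioid.toElem Φ (zeroMonoid.{0} D) DivB) (model_isFrobenioid DivB) hsq).obj A ⟶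
            (toBirat (ModelFrobenioid.toElem Φ (zeroMonoid.{0} D) DivB) (model_isFrobenioid DivB) hsq).obj A'),
          Birat.gpDiv f ∈ P (baseObj (ModelFrobenioid.toElem Φ (zeroMonoid.{0} D) DivB) A)) ∧
      (∀ A : ModelFrobenioid Φ (zeroMonoid.{0} D) DivB,
        ∀ y ∈ P (baseObj (ModelFrobenioid.toElem Φ (zeroMonoid.{0} D) DivB) A),
          ∃ u, biratDivHom (model_isFrobenioid DivB) hsq A u = y) := by
  rintro ⟨P, hfac, hsurj⟩
  obtain ⟨A, A', f, hf⟩ := exists_gpDiv_eq_of_one DivB hsq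
  obtain ⟨u, hu⟩ := hsurj A _ (hf ▸ hfac A A' f)
  rw [biratDivHom_eq_one] at hu
  -- `hu : 1 = of (ofAdd 1)` in `Φ^gp(∗) = ℤ`: read its parity
  have h := congrArg (Algebra.GrothendieckGroup.lift
    (M := Φ.obj (op (baseObj (ModelFrobenioid.toElem Φ (zeroMonoid.{0} D) DivB) A)))
    (AddMonoidHom.toMultiplicative (Nat.castAddMonoidHom (ZMod 2)) : M →* Multiplicative (ZMod 2))) hu
  rw [map_one, parity_of] at h
  -- `h : 1 = ofAdd (par 1)`, i.e. `(0 : ZMod 2) = 1`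
  have h' : (0 : ZMod 2) = ((1 : ℕ) : ZMod 2) := congrArg Multiplicative.toAdd h
  exact absurd h' (by decide)

/-- **Consequently [FrdI] Prop. 4.4 (iii) AS PRINTED (with the factorization clause) fails for some
Frobenioid of isotropic and model type** — the model Frobenioid above, for the (unique) `Div_B : 0_D → Φ^gp`
and the canonical composition squares of a Frobenioid. [cite: MochizukiFrdI2008, Prop. 4.4 (iii) p.83] -/
theorem prop44iii_factorization_clause_fails :
    ∃ (DivB : zeroMonoid.{0} D ⟶ monoidGp Φ)
      (hF : IsFrobenioid (ModelFrobenioid.toElem Φ (zeroMonoid.{0} D) DivB)),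
      ¬ ∃ P : ∀ Y : D, Subgroup (Algebra.GrothendieckGroup (Φ.obj (op Y))),
        (∀ (A A' : ModelFrobenioid Φ (zeroMonoid.{0} D) DivB)
            (f : (toBirat _ hF (hasBiratSquares_of_isFrobenioid hF)).obj A ⟶
              (toBirat _ hF (hasBiratSquares_of_isFrobenioid hF)).obj A'),
            Birat.gpDiv f ∈ P (baseObj (ModelFrobenioid.toElem Φ (zeroMonoid.{0} D) DivB) A)) ∧
        (∀ A : ModelFrobenioid Φ (zeroMonoid.{0} D) DivB,
          ∀ y ∈ P (baseObj (ModelFrobenioid.toElem Φ (zeroMonoid.{0} D) DivB) A),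
            ∃ u, biratDivHom hF (hasBiratSquares_of_isFrobenioid hF) A u = y) := by
  obtain ⟨DivB⟩ := nonempty_divB
  exact ⟨DivB, model_isFrobenioid DivB, not_exists_factorization_and_surjection DivB _⟩

end TwoLevel

end Literature.AlgebraicGeometry.Frobenioids
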